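import Summits.ResolutionOfSingularities.ResolutionOfSingularities.Theorems.EquisingularLiftEquisingularLiftNatVerticalCentre
import Summits.ResolutionOfSingularities.ResolutionOfSingularities.Theorems.EquisingularLiftEquisingularLiftCentreBlowupSmooth
import Literature.AlgebraicGeometry.Motives.GoodReductionSpecialFibreProofs
import HarnessLib

/-!
# [OURS · L1 W4.5(b) · EL♮] HORIZONTALITY IS FORCED (general base): an E1 chain of the item whose LAST special fibre is
# irreducible is a HORIZONTAL E1 chain — every centre is `O`-flat
# (crux `EquisingularLiftNat` = stmt-ResolutionOfSingularities-20038; object T-HORIZ-FORCED, part 1 of 2)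

HONEST FRAMING. OURS (cell res-hironaka, crux chain w45b, slot W4.5(b)); NOT a statement of any manuscript; replaces the role
of NOTHING in the manuscript; AI-written, AI review is weaker than expert review. Helper `--supports
stmt-ResolutionOfSingularities-20038 --as helper` (any-`n` object). It turns the informal remark of p500485's module docstring
(«an admissible centre with a vertical component makes the special fibre reducible for good … so every successful EL♮ chain is
horizontal anyway», res-L1-w45b-lead-2 LEAD-MEMO-1 §1) into a theorem: the CONVERSE of
`natChain_and_isIrreducible_of_horizChainE1` (p500485). The V-pack (p503337 / p504712 / p505870) proved horizontality only AT
THE TOUCHING POINT of the first touching centre; here it is proved for EVERY centre of EVERY successful chain, and upgraded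
from the topological clause «a generisation inside the centre off the special fibre» to FLATNESS over `Spec O`.

THE ARGUMENT. Run the item's E1-closure on the motive «(locally Noetherian ∧ quasi-compact) ∧ integral ∧ generic point off
the special fibre ∧ special fibre non-empty ∧ `Y′ ⊆` special fibre ∧ no maximal point of the special fibre in `closure Y′`»
∧ («the special fibre has two maximal points» ∨ «horizontally reachable»). Two maximal points persist to the end
(`exists_two_maxPt_preimage_of_step`, p503337) and contradict the irreducibility of the LAST special fibre; so at every step
both special fibres are irreducible, the generic point of the current one is off the centre (E1 + no maximal point in
`closure Y′`), every point of the centre has a generisation inside the centre off the special fibre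
(`exists_horizontal_generization_of_isIrreducible`, p504712: Krull at a maximal point of the exceptional Cartier divisor), and
a REGULAR centre with that property is `O`-FLAT (`flat_subschemeι_comp_of_horizontal`: regular local rings are domains,
`Spec O = {η, s₀}`, and a locally Noetherian scheme with domain stalks all of whose points generise over `η` is flat over the
PID `O` — affine-locally on integral open neighbourhoods, `flat_of_isIntegral_of_isDominant`).

* `flat_of_isDomain_stalk_of_generization` — flatness over a PID from generisations over the generic point;
* `flat_subschemeι_comp_of_horizontal` — topological horizontality of a regular centre over a DVR is flatness;
* `horizChain_of_natChain_of_isIrreducible` — THE OBJECT (general base `q : P → Spec O`, `P` integral Noetherian, generic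
  point off the special fibre, `Y` inside the special fibre and off its maximal points): typed chain + irreducible last
  special fibre ⇒ horizontal chain, in the hypothesis shape of p500485 VERBATIM.
Part 2 (`…NatHorizontalForcedAmbient.lean`) specialises to the item's ambient `ℙⁿ_O`: `ELNatOver ↔ horizontal form`,
`ELNatAt ↔ …`, `EquisingularLiftNat p ↔ its horizontal form` (any `n`).

References: GW I Prop. 13.91, Ex. 3.16 [GortzWedhorn2020]; Hartshorne III Prop. 9.7 [Hartshorne1977]; Krull; tree files
`…NatVerticalCentre` (p504712), `…NatSpecialFibreMaxPoints` (p503337), `…CampaignW45bULTSpecialFibrePersists`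
(res-type-100: `surjective_of_isBlowup`), `…CentreBlowupSmooth` (`flat_of_isIntegral_of_isDominant`),
`Literature…GoodReductionSpecialFibreProofs` (`exists_isOpen_isIrreducible_of_isDomain_stalk`).
-/

set_option linter.dupNamespace false -- mandated namespace `Summit.<Summit>.<Problem>` of this single-conjunct summit
set_option linter.overlappingInstances false -- item signatures carry `[IsDomain O] [IsDiscreteValuationRing O]`

open CategoryTheory AlgebraicGeometry TopologicalSpace Topology
open Literature.AlgebraicGeometry.Resolution
open AlgebraicGeometry.Scheme.IdealSheafData
open Summit.ResolutionOfSingularities.ResolutionOfSingularities.Cruxes.EquisingularLift.StrataSplit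
open Summit.ResolutionOfSingularities.ResolutionOfSingularities.Theorems.EquisingularLift

namespace Summit.ResolutionOfSingularities.ResolutionOfSingularities.Cruxes.EquisingularLiftNat.Sections

/-! ## Flatness over a principal ideal domain from generisations over the generic point -/

/-- **Flat over a PID from horizontality, point by point.** Let `R` be a principal ideal domain and `Z` a locally
Noetherian scheme whose local rings are domains, `g : Z → Spec R`. If every point `z` of `Z` has a generisation `c ⤳ z`
lying over the generic point of `Spec R`, then `g` is flat: every point has an irreducible — hence integral — open
neighbourhood (Görtz–Wedhorn I Ex. 3.16), which is dominant over `Spec R`, and an integral scheme dominant over a PID is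
flat (torsion-free over a Bézout domain; Hartshorne III 9.7). [folklore; GW I Ex. 3.16, Hartshorne III Prop. 9.7] -/
theorem flat_of_isDomain_stalk_of_generization {R : Type} [CommRing R] [IsDomain R] [IsPrincipalIdealRing R]
    {Z : Scheme.{0}} [IsLocallyNoetherian Z] (hdom : ∀ z : Z, IsDomain (Z.presheaf.stalk z))
    (g : Z ⟶ Spec (.of R)) (hgen : ∀ z : Z, ∃ c : Z, c ⤳ z ∧ (g c).asIdeal = ⊥) : Flat g := by
  -- `Z` is reduced
  haveI : IsReduced Z := by
    haveI : ∀ z : Z, _root_.IsReduced (Z.presheaf.stalk z) := fun z => by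
      haveI := hdom z
      infer_instance
    exact isReduced_of_isReduced_stalk Z
  -- every point has an irreducible open neighbourhood; these cover `Z`
  have hnbhd : ∀ z : Z, ∃ W : Z.Opens, z ∈ W ∧ IsIrreducible (W : Set Z) := fun z => by
    haveI := hdom z
    obtain ⟨W, hWo, hzW, hWirr⟩ :=
      Literature.AlgebraicGeometry.Motives.exists_isOpen_isIrreducible_of_isDomain_stalk Z z
    exact ⟨⟨W, hWo⟩, hzW, hWirr⟩
  choose W hzW hWirr using hnbhd
  refine IsZariskiLocalAtSource.of_iSup_eq_top (P := @Flat) W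
    (top_le_iff.mp fun z _ => Opens.mem_iSup.mpr ⟨z, hzW z⟩) fun z => ?_
  -- the open subscheme `W z` is integral …
  haveI : IrreducibleSpace ((W z : Z.Opens) : Scheme.{0}) := Subtype.irreducibleSpace (hWirr z)
  haveI : IsIntegral ((W z : Z.Opens) : Scheme.{0}) := isIntegral_of_irreducibleSpace_of_isReduced _
  -- … and dominant over `Spec R`: its image contains the generic point
  obtain ⟨c, hcz, hc⟩ := hgen z
  have hcW : c ∈ (W z : Z.Opens) := hcz.mem_open (W z).2 (hzW z)
  haveI : IsDominant ((W z).ι ≫ g) := by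
    refine ⟨fun x => ?_⟩
    have hx : g c ⤳ x := (PrimeSpectrum.le_iff_specializes _ _).mp (by
      change (g c).asIdeal ≤ x.asIdeal
      rw [hc]; exact bot_le)
    have hmem : g c ∈ Set.range ((W z).ι ≫ g) := ⟨⟨c, hcW⟩, by rw [Scheme.Hom.comp_apply]; rfl⟩
    exact closure_mono (Set.singleton_subset_iff.mpr hmem) (specializes_iff_mem_closure.mp hx)
  exact flat_of_isIntegral_of_isDominant ((W z).ι ≫ g)

/-- **Topological horizontality of a regular centre over a DVR is flatness.** Let `O` be a discrete valuation ring,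
`f : X → Spec O` with `X` locally Noetherian, and `C` an ideal sheaf on `X` with `V(C)` regular. If every point `x₀` of
`supp C` has a generisation `c ⤳ x₀` inside `supp C` OFF the special fibre `f⁻¹{s₀}` (the horizontality clause of `ULTAt`,
produced by `exists_horizontal_generization_of_isIrreducible`, p504712), then `V(C) → Spec O` is FLAT: the local rings of
`V(C)` are regular, hence domains, and `Spec O = {η, s₀}`. [folklore] -/
theorem flat_subschemeι_comp_of_horizontal {O : Type} [CommRing O] [IsDomain O] [IsDiscreteValuationRing O]
    {X : Scheme.{0}} [IsLocallyNoetherian X] (f : X ⟶ Spec (.of O)) (C : X.IdealSheafData)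
    (hC : Scheme.IsRegular C.subscheme)
    (hhor : ∀ x₀ ∈ (C.support : Set X), ∃ c ∈ (C.support : Set X),
      c ∉ f ⁻¹' {IsLocalRing.closedPoint O} ∧ c ⤳ x₀) :
    Flat (C.subschemeι ≫ f) := by
  haveI : IsLocallyNoetherian C.subscheme := LocallyOfFiniteType.isLocallyNoetherian C.subschemeι
  have hdom : ∀ z : C.subscheme, IsDomain (C.subscheme.presheaf.stalk z) := fun z => by
    haveI := hC z
    exact isDomain_of_isRegularLocalRing _
  refine flat_of_isDomain_stalk_of_generization hdom (C.subschemeι ≫ f) fun z => ?_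
  have hz : C.subschemeι z ∈ (C.support : Set X) := by
    rw [← range_subschemeι]; exact ⟨z, rfl⟩
  obtain ⟨c, hc, hcF, hcz⟩ := hhor _ hz
  rw [← range_subschemeι] at hc
  obtain ⟨c', rfl⟩ := hc
  refine ⟨c', (C.subschemeι.isClosedEmbedding.isInducing.specializes_iff).mp hcz, ?_⟩
  -- `f (ι c')` is not the closed point, hence it is the generic point of `Spec O`
  rcases IsLocalRing.Ring.KrullDimLE.eq_bot_or_eq_top ((C.subschemeι ≫ f) c') with h | h
  · rw [h]; rfl
  · exfalso
    apply hcF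
    show f (C.subschemeι c') = IsLocalRing.closedPoint O
    rw [← Scheme.Hom.comp_apply, h]
    rfl


/-! ## Horizontality is forced (general base) -/

/-- **HORIZONTALITY IS FORCED (general base).** Let `O` be a discrete valuation ring, `P` an integral Noetherian scheme
over `q : P → Spec O` whose generic point is off the special fibre `F = q⁻¹{s₀}`, and `Y ⊆ F` containing no maximal point
of `F`. If `(P′, σ, S′)` lies in the inductive closure of `(P, 𝟙, Y)` under the item's E1-steps (blow-ups `τ` at ideal
sheaves `C` with `V(C)` regular, `σ′(supp C)` off the generic points of `Y`, special support inside `Y′`) and the LAST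
special fibre `(σ ≫ q)⁻¹{s₀}` is irreducible, then `(P′, σ, S′)` already lies in the closure under the HORIZONTAL E1-steps
(the same, plus `V(C) → Spec O` FLAT) — the hypothesis shape of `natChain_and_isIrreducible_of_horizChainE1` (p500485).
Induction on the closure with motive «structural invariants ∧ (the special fibre has two maximal points ∨ horizontally
reachable)»: reducibility of a special fibre persists to the end (`exists_two_maxPt_preimage_of_step`, p503337), so along a
successful chain every special fibre is irreducible, the generic point of the current special fibre is off the centre
(no maximal point of the special fibre lies in `closure Y′ ⊇ supp C ∩ F′`), every point of the centre has a horizontal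
generisation inside the centre (`exists_horizontal_generization_of_isIrreducible`, p504712: Krull at a maximal point of
the exceptional divisor), and a regular centre with this property is `O`-flat (`flat_subschemeι_comp_of_horizontal`).
[folklore; GW I Prop. 13.91, Krull, Hartshorne III 9.7] -/
theorem horizChain_of_natChain_of_isIrreducible {O : Type} [CommRing O] [IsDomain O] [IsDiscreteValuationRing O]
    {P : AlgebraicGeometry.Scheme.{0}} [AlgebraicGeometry.IsIntegral P] [AlgebraicGeometry.IsLocallyNoetherian P]
    [CompactSpace P] (q : P ⟶ AlgebraicGeometry.Spec (.of O)) (Y : Set P) {P' : AlgebraicGeometry.Scheme.{0}}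
    (σ : P' ⟶ P) (S' : Set P')
    (hch : (∀ Q : (∀ X' : AlgebraicGeometry.Scheme.{0}, (X' ⟶ P) → Set X' → Prop), Q P (CategoryTheory.CategoryStruct.id _) Y → (∀ (X' X'' : AlgebraicGeometry.Scheme.{0}) (σ' : X' ⟶ P) (Y' : Set X') (C : X'.IdealSheafData) (τ : X'' ⟶ X'), Q X' σ' Y' → Literature.AlgebraicGeometry.Resolution.IsBlowup τ C → Literature.AlgebraicGeometry.Resolution.Scheme.IsRegular C.subscheme → σ' '' (C.support : Set X') ⊆ {x | ¬ IsGenericPoint x Y} → (C.support : Set X') ∩ (CategoryTheory.CategoryStruct.comp σ' q) ⁻¹' {IsLocalRing.closedPoint O} ⊆ Y' → Q X'' (CategoryTheory.CategoryStruct.comp τ σ') (closure (τ ⁻¹' (Y' \ (C.support : Set X'))))) → Q P' σ S'))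
    (hirr : IsIrreducible ((CategoryTheory.CategoryStruct.comp σ q) ⁻¹' {IsLocalRing.closedPoint O}))
    (hgenP : ∀ ξ : P, IsGenericPoint ξ (Set.univ : Set P) → ξ ∉ q ⁻¹' {IsLocalRing.closedPoint O})
    (hYF : Y ⊆ q ⁻¹' {IsLocalRing.closedPoint O})
    (hNM : ∀ w : P, (w ∈ q ⁻¹' {IsLocalRing.closedPoint O} ∧ ∀ y ∈ q ⁻¹' {IsLocalRing.closedPoint O}, y ⤳ w → y = w) →
      w ∉ closure Y) :
    (∀ Q : (∀ X' : AlgebraicGeometry.Scheme.{0}, (X' ⟶ P) → Set X' → Prop), Q P (CategoryTheory.CategoryStruct.id _) Y → (∀ (X' X'' : AlgebraicGeometry.Scheme.{0}) (σ' : X' ⟶ P) (Y' : Set X') (C : X'.IdealSheafData) (τ : X'' ⟶ X'), Q X' σ' Y' → Literature.AlgebraicGeometry.Resolution.IsBlowup τ C → Literature.AlgebraicGeometry.Resolution.Scheme.IsRegular C.subscheme → AlgebraicGeometry.Flat (CategoryTheory.CategoryStruct.comp C.subschemeι (CategoryTheory.CategoryStruct.comp σ' q)) → σ' '' (C.support :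 Set X') ⊆ {x | ¬ IsGenericPoint x Y} → (C.support : Set X') ∩ (CategoryTheory.CategoryStruct.comp σ' q) ⁻¹' {IsLocalRing.closedPoint O} ⊆ Y' → Q X'' (CategoryTheory.CategoryStruct.comp τ σ') (closure (τ ⁻¹' (Y' \ (C.support : Set X'))))) → Q P' σ S') := by
  -- local abbreviations
  let F : ∀ X' : Scheme.{0}, (X' ⟶ P) → Set X' := fun X' σ' =>
    (CategoryTheory.CategoryStruct.comp σ' q) ⁻¹' {IsLocalRing.closedPoint O}
  let MP : ∀ X' : Scheme.{0}, Set X' → X' → Prop := fun X' F w => w ∈ F ∧ ∀ y ∈ F, y ⤳ w → y = w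
  let RED : ∀ X' : Scheme.{0}, (X' ⟶ P) → Prop := fun X' σ' =>
    ∃ w₁ w₂ : X', MP X' (F X' σ') w₁ ∧ MP X' (F X' σ') w₂ ∧ w₁ ≠ w₂
  let NM : ∀ X' : Scheme.{0}, (X' ⟶ P) → Set X' → Prop := fun X' σ' Y' =>
    ∀ w : X', MP X' (F X' σ') w → w ∉ closure Y'
  let HR : ∀ X' : Scheme.{0}, (X' ⟶ P) → Set X' → Prop := fun X₀ σ₀ Y₀ =>
    (∀ Q : (∀ X' : AlgebraicGeometry.Scheme.{0}, (X' ⟶ P) → Set X' → Prop), Q P (CategoryTheory.CategoryStruct.id _) Y → (∀ (X' X'' : AlgebraicGeometry.Scheme.{0}) (σ' : X' ⟶ P) (Y' : Set X') (C : X'.IdealSheafData) (τ : X'' ⟶ X'), Q X' σ' Y' → Literature.AlgebraicGeometry.Resolution.IsBlowup τ C → Literature.AlgebraicGeometry.Resolution.Scheme.IsRegular C.subscheme → AlgebraicGeometry.Flat (CategoryTheory.CategoryStruct.comp C.subschemeι (CategoryTheory.CategoryStruct.comp σ' q)) → σ' '' (C.support : Set X') ⊆ {x | ¬ IsGenericPoint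 x Y} → (C.support : Set X') ∩ (CategoryTheory.CategoryStruct.comp σ' q) ⁻¹' {IsLocalRing.closedPoint O} ⊆ Y' → Q X'' (CategoryTheory.CategoryStruct.comp τ σ') (closure (τ ⁻¹' (Y' \ (C.support : Set X'))))) → Q X₀ σ₀ Y₀)
  have hFcl : ∀ (X' : Scheme.{0}) (σ' : X' ⟶ P), IsClosed (F X' σ') := fun X' σ' =>
    (IsLocalRing.isClosed_singleton_closedPoint O).preimage (CategoryTheory.CategoryStruct.comp σ' q).base.hom.continuous
  have hFstep : ∀ (X' X'' : Scheme.{0}) (σ' : X' ⟶ P) (τ : X'' ⟶ X'),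
      F X'' (CategoryTheory.CategoryStruct.comp τ σ') = τ ⁻¹' F X' σ' := by
    intro X' X'' σ' τ
    ext v
    simp only [F, Set.mem_preimage, Scheme.Hom.comp_apply]
  -- run the E1-closure
  have key := hch (fun X' σ' Y' => ((IsLocallyNoetherian X' ∧ CompactSpace X') ∧ IsIntegral X' ∧
      (∀ ξ : X', IsGenericPoint ξ (Set.univ : Set X') → ξ ∉ F X' σ') ∧ (F X' σ').Nonempty ∧ Y' ⊆ F X' σ' ∧
      NM X' σ' Y') ∧ (RED X' σ' ∨ HR X' σ' Y')) ?_ ?_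
  · obtain ⟨-, hred | hH⟩ := key
    · obtain ⟨w₁, w₂, hw₁, hw₂, hne⟩ := hred
      exact absurd (maxPt_unique_of_isIrreducible hirr (hFcl P' σ) hw₁ hw₂) hne
    · exact hH
  · -- base
    refine ⟨⟨⟨inferInstance, inferInstance⟩, inferInstance, ?_, ?_, ?_, ?_⟩, Or.inr (fun Q h0 _ => h0)⟩
    · simpa [F] using hgenP
    · obtain ⟨v, hv⟩ := hirr.nonempty
      refine ⟨σ v, ?_⟩
      simpa [F, Scheme.Hom.comp_apply] using hv
    · simpa [F] using hYF
    · simpa [NM, MP, F] using hNM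
  · intro X' X'' σ' Y' C τ hQ hbl hC hgen hE1
    obtain ⟨⟨⟨hN', hc'⟩, hint, hgen', hne', hSF, hnm⟩, hQ⟩ := hQ
    haveI := hN'
    haveI := hc'
    haveI := hint
    haveI : IsProper τ := hbl.isProper
    haveI : IsLocallyNoetherian X'' := LocallyOfFiniteType.isLocallyNoetherian τ
    haveI : CompactSpace X'' := QuasiCompact.compactSpace_of_compactSpace τ
    haveI : AlgebraicGeometry.IsNoetherian X'' := AlgebraicGeometry.IsNoetherian.mk
    have hF'' : F X'' (CategoryTheory.CategoryStruct.comp τ σ') = τ ⁻¹' F X' σ' := hFstep X' X'' σ' τ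
    -- maximal points of the special fibre are off the centre
    have hNMC : ∀ w, MP X' (F X' σ') w → w ∉ (C.support : Set X') := fun w hw hwC =>
      hnm w hw (subset_closure (hE1 ⟨hwC, hw.1⟩))
    -- the centre is a genuine ideal sheaf
    have hC0 : C ≠ ⊥ := by
      rintro rfl
      obtain ⟨v, hv⟩ := hne'
      obtain ⟨m, hm, -⟩ := exists_maxPt_specializes (hFcl X' σ') hv
      apply hNMC m hm
      rw [Scheme.IdealSheafData.support_bot]; trivial
    haveI : IsIntegral X'' := hbl.isIntegral hC0
    have hsurj : Function.Surjective τ := surjective_of_isBlowup hbl hC0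
    -- persistence of the structural invariants
    have hgenX' : genericPoint X' ∉ F X' σ' := hgen' _ (genericPoint_spec X')
    have hgen'' : ∀ ξ : X'', IsGenericPoint ξ (Set.univ : Set X'') →
        ξ ∉ F X'' (CategoryTheory.CategoryStruct.comp τ σ') := by
      intro ξ hξ
      rw [hF'']
      have hτξ : IsGenericPoint (τ ξ) (Set.univ : Set X') := by
        have h1 := hξ.image τ.base.hom.continuous
        rwa [Set.image_univ, hsurj.range_eq, closure_univ] at h1
      show τ ξ ∉ F X' σ'
      exact hgen' _ hτξ
    have hne'' : (F X'' (CategoryTheory.CategoryStruct.comp τ σ')).Nonempty := by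
      obtain ⟨v, hv⟩ := hne'
      obtain ⟨m, hm, -⟩ := exists_maxPt_specializes (hFcl X' σ') hv
      obtain ⟨m'', hm'', -, -⟩ := exists_maxPt_preimage_of_step τ C hbl (F X' σ') hm (hNMC m hm)
      exact ⟨m'', by rw [hF'']; show τ m'' ∈ F X' σ'; rw [hm'']; exact hm.1⟩
    have hSF'' : closure (τ ⁻¹' (Y' \ (C.support : Set X'))) ⊆ F X'' (CategoryTheory.CategoryStruct.comp τ σ') := by
      rw [hF'']
      exact closure_minimal (fun v ⟨hv, _⟩ => hSF hv) ((hFcl X' σ').preimage τ.base.hom.continuous)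
    have hnm'' : NM X'' (CategoryTheory.CategoryStruct.comp τ σ') (closure (τ ⁻¹' (Y' \ (C.support : Set X')))) := by
      intro w hw
      rw [hF''] at hw
      exact maxPt_not_mem_strictTransform_of_step τ C hbl (F X' σ') (hFcl X' σ') Y' hSF hnm w hw
    have hredstep : RED X' σ' → RED X'' (CategoryTheory.CategoryStruct.comp τ σ') := by
      intro hred
      obtain ⟨v₁, v₂, hv₁, hv₂, hne⟩ := exists_two_maxPt_preimage_of_step τ C hbl (F X' σ') hNMC hred
      refine ⟨v₁, v₂, ?_, ?_, hne⟩
      · rw [hF'']; exact hv₁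
      · rw [hF'']; exact hv₂
    refine ⟨⟨⟨inferInstance, inferInstance⟩, inferInstance, hgen'', hne'', hSF'', hnm''⟩, ?_⟩
    rcases hQ with hred | hHR
    · exact Or.inl (hredstep hred)
    · by_cases hred : RED X' σ' ∨ RED X'' (CategoryTheory.CategoryStruct.comp τ σ')
      · rcases hred with h | h
        · exact Or.inl (hredstep h)
        · exact Or.inl h
      · -- both special fibres are irreducible: the centre is horizontal, hence flat
        push Not at hred
        obtain ⟨hred', hred''⟩ := hred
        have huniq' : ∀ w₁ w₂, MP X' (F X' σ') w₁ → MP X' (F X' σ') w₂ → w₁ = w₂ := by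
          intro w₁ w₂ h₁ h₂; by_contra hne; exact hred' ⟨w₁, w₂, h₁, h₂, hne⟩
        have huniq'' : ∀ w₁ w₂, MP X'' (F X'' (CategoryTheory.CategoryStruct.comp τ σ')) w₁ →
            MP X'' (F X'' (CategoryTheory.CategoryStruct.comp τ σ')) w₂ → w₁ = w₂ := by
          intro w₁ w₂ h₁ h₂; by_contra hne; exact hred'' ⟨w₁, w₂, h₁, h₂, hne⟩
        have hirr' : IsIrreducible (F X' σ') := isIrreducible_of_maxPt_unique (hFcl X' σ') hne' huniq'
        have hirr'' : IsIrreducible (τ ⁻¹' F X' σ') := by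
          rw [← hF'']
          exact isIrreducible_of_maxPt_unique (hFcl X'' _) hne'' huniq''
        -- the generic point of the special fibre is off the centre
        obtain ⟨ζ, hζ⟩ := QuasiSober.sober hirr' (hFcl X' σ')
        have hζmax : MP X' (F X' σ') ζ := ⟨hζ.mem, fun y hy hyζ => ((hζ.specializes hy).antisymm hyζ).eq.symm⟩
        have hζC : ζ ∉ (C.support : Set X') := hNMC ζ hζmax
        have hflat : AlgebraicGeometry.Flat (CategoryTheory.CategoryStruct.comp C.subschemeι
            (CategoryTheory.CategoryStruct.comp σ' q)) :=
          flat_subschemeι_comp_of_horizontal (CategoryTheory.CategoryStruct.comp σ' q) C hC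
            (fun x₀ hx₀ => exists_horizontal_generization_of_isIrreducible τ C hbl hC0 (F X' σ')
              (hFcl X' σ') hgenX' hζ hζC hirr'' hx₀)
        exact Or.inr (fun Q h0 hs => hs X' X'' σ' Y' C τ (hHR Q h0 hs) hbl hC hflat hgen hE1)

end Summit.ResolutionOfSingularities.ResolutionOfSingularities.Cruxes.EquisingularLiftNat.Sections
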